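import Literature.NumberTheory.GaloisRepresentations.SUnitsRestrictedLayersTransitions
import Literature.NumberTheory.GaloisRepresentations.RestrictedRamificationSUnitsLayerSupplyTwo
import Literature.NumberTheory.GaloisCohomology.RestrictedRamificationSUnitsLayerSupplyThree
import Literature.NumberTheory.GaloisCohomology.RestrictedRamificationCdTwoOfSUnitsCohomology
import HarnessLib

/-!
# Harari Thm. 17.13 (a) at TOTALLY COMPLEX number fields: the named fact
# `poitouTate_restricted_three_le K` DISCHARGED (via NSW (8.3.18) `cd_p G_{K,S} ≤ 2`)

Topic `NumberTheory/GaloisCohomology`; namespace `Literature.NumberTheory.GaloisCohomology`.  THEOREMS ONLY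
(no definition, no named fact, no `sorry`, no instance; D-0026).  Lane «PT3-TC» of cell `bsd-eis` (crux
`GoodLatticeBDPValue`, stmt-BirchSwinnertonDyer-19032; road memo `PT3TC-ROAD.md`), brick (A5) = THE ASSEMBLY.

MAIN RESULTS
* **`poitouTate_restricted_three_le_of_isTotallyComplex (K) [IsTotallyComplex K] : poitouTate_restricted_three_le K`**
  — the Literature named fact (Harari Thm. 17.13 (a): `P³_S` injective, for all `S` and all finite Galois modules
  unramified outside `S`, restricted-ramification version) PROVED at every totally complex number field;
  `forall_poitouTate_restricted_three_le_of_isTotallyComplex` is the `∀ K`-closed form;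
* **`groupCdLE_two_galoisGroupUnramifiedOutside_of_isTotallyComplex (K) [IsTotallyComplex K]`** — NSW (8.3.18)
  `cd_p G_{K,S} ≤ 2` for all `S ⊇ S_p` at totally complex `K`;
* `sUnits_cohomology_two_three`: NSW's limit statements (iii) `p · H²(U, E_S) = H²(U, E_S)` and (iv)
  `H³(U, E_S)[p] = 0` for every open `U = H/N_S ≤ G_{K,S}`, `S ⊇ S_p` finite, `K` totally complex.

PROOF (the lane's ORDER OF WORK, all bricks in the tree): (A1)/(A1c) the `S`-units `E_S` of `K_S` as a discrete
`G_{K,S}`-module, `p`-divisible with `E_S[p] = μ_p` (`SUnitsGaloisModule`, `SUnitsRestrictedKummer`); (A2) `Hⁿ(U, E_S)`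
is the colimit of the layers `Hⁿ(Gal(E/F₀), 𝒪_{E,S}ˣ)` with the inflations as transitions
(`DiscreteRepLayerColimitDivisibility`, `RestrictedRamificationOpenSubgroupLayers`, `SUnitsRestrictedLayers`,
`SUnitsLayerInflation`, `SUnitsRestrictedLayersTransitions`); (A3)/(A4) NSW (8.3.11) (iii)/(iv) at the finite layers —
every `c ∈ H²(Gal(E/F₀), 𝒪_{E,S}ˣ)` becomes `p`-divisible, and every `p`-torsion `c ∈ H³` dies, after inflation to the
cyclotomic-degree layer followed by a capitulation layer inside `K_S` (idèle cohomology `IdeleSUnits*`, capitulation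
`RestrictedRamificationCapitulationLayer`, cyclotomic degrees `IdeleLocalDegreeCyclotomicGrowth`, bridge
`SUnitsIdeleBridge` / `SUnitsLayerBridgeTransport`, layers `RestrictedRamificationCycCapLayers`, supplies
`RestrictedRamificationSUnitsLayerSupplyTwo` / `…Three`); (A5-α)/(A5-ω) the Kummer sequence of `E_S` turns (iii)/(iv)
into `H³(U, μ_p) = 0` for all open `U`, whence `cd_p G_{K,S} ≤ 2` (Serre's criterion,
`CohomologicalDimensionOpenSubgroupCriterion`, `RestrictedRamificationCdTwoOfH3Mu`), for all `S` by the limit over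
finite `S` (`RestrictedRamificationH3MuOfFinite`), and `P³_S` injective at totally complex `K`
(`RestrictedRamificationPoitouTateThreeLeOfCdTwo`: `H³(G_S, M) = 0`).  This file is the last composition; the generic
`sUnits_cohomology_of_layerSupply` records that the two layer-supply statements are exactly what the (A2) discharge
consumes (`GalLayer` ↔ `IntermediateField` repackaging).

Cell `bsd-eis`: seats -w2 g8, -w3 g14, -w4 g16, -w5 g6, -w6 g8, -w7 g8, -w8 g9 (router) of line `x1-p1`.

## References
* J. Neukirch, A. Schmidt, K. Wingberg, *Cohomology of Number Fields*, 2nd ed. (2008), (8.3.11) (iii)–(iv), (8.3.18),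
  (10.11.3). [NeukirchSchmidtWingberg2008]
* D. Harari, *Galois Cohomology and Class Field Theory* (2020), Thm. 17.13 (a), Cor. 17.14, Lemma 17.21.
  [Harari2020]
* J.-P. Serre, *Cohomologie galoisienne* (1994), I §3.3 Prop. 14, I §4.1 Prop. 21, II §4.4 Prop. 13. [SerreGaloisCohomology1997]
-/


noncomputable section

open NumberField IsDedekindDomain Field Topology CategoryTheory
open Literature.NumberTheory.GaloisRepresentations
open Literature.NumberTheory.GaloisRepresentations.IdeleClassBar (GalLayer)
open Literature.NumberTheory.GaloisRepresentations.LocalWeilDatum (galFixing)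
open Literature.NumberTheory.GaloisRepresentations.OpenSubgroupLayer (algOfLE baseField)
open Literature.NumberTheory.GaloisRepresentations.SUnits (sUnitsRep)
open Literature.NumberTheory.GaloisRepresentations.SUnits.Layers (layerInf resRep)

namespace Literature.NumberTheory.GaloisCohomology

variable {K : Type} [Field K] [NumberField K]

/-- **(iii) and (iv) for `U = H/N_S` from the layer supplies at all finite Galois `E ⊇ K̄^H` inside `K_S`**
((A2-β2) discharge; `GalLayer` ↔ `IntermediateField` repackaging).
[cite: NeukirchSchmidtWingberg2008, (8.3.11) (iii)–(iv), proof of (8.3.18)] -/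
theorem sUnits_cohomology_of_layerSupply (S : Set (HeightOneSpectrum (𝓞 K))) (p : ℕ)
    (H : Subgroup (absoluteGaloisGroup K)) (hHo : IsOpen (H : Set (absoluteGaloisGroup K)))
    (hNH : ramificationSubgroup K S ≤ H)
    (h2 : ∀ {F₀ E : IntermediateField K (AlgebraicClosure K)} [FiniteDimensional K E] [IsGalois K E]
      (hF : F₀ ≤ E) (_ : ramificationSubgroup K S ≤ galFixing K E)
      (c : letI := algOfLE hF; groupCohomology (sUnitsRep K S F₀ E) 2),
      ∃ (E' : IntermediateField K (AlgebraicClosure K)) (_ : FiniteDimensional K E') (_ : IsGalois K E')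
        (hEE' : E ≤ E') (_ : ramificationSubgroup K S ≤ galFixing K E')
        (z : letI := algOfLE (hF.trans hEE'); groupCohomology (sUnitsRep K S F₀ E') 2),
        p • z = layerInf S hF hEE' 2 c)
    (h3 : ∀ {F₀ E : IntermediateField K (AlgebraicClosure K)} [FiniteDimensional K E] [IsGalois K E]
      (hF : F₀ ≤ E) (_ : ramificationSubgroup K S ≤ galFixing K E)
      (c : letI := algOfLE hF; groupCohomology (sUnitsRep K S F₀ E) 3), p • c = 0 →
      ∃ (E' : IntermediateField K (AlgebraicClosure K)) (_ : FiniteDimensional K E') (_ : IsGalois K E')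
        (hEE' : E ≤ E') (_ : ramificationSubgroup K S ≤ galFixing K E'), layerInf S hF hEE' 3 c = 0) :
    (∀ y : continuousCohomology 2 (resRep K S H).toTopRep,
        ∃ z : continuousCohomology 2 (resRep K S H).toTopRep, p • z = y) ∧
      (∀ y : continuousCohomology 3 (resRep K S H).toTopRep, p • y = 0 → y = 0) := by
  refine ⟨fun y => SUnits.Layers.continuousCohomology_nsmul_surjective_of_layerSupply hHo hNH 2 p
      (fun E hF hS c => ?_) y,
    fun y hy => SUnits.Layers.continuousCohomology_eq_zero_of_nsmul_eq_zero_of_layerSupply hHo hNH 3 p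
      (fun E hF hS c hc => ?_) y hy⟩
  · haveI := E.finiteDimensional
    haveI := E.isGalois
    obtain ⟨E', hfd, hgal, hEE', hS', z, hz⟩ := h2 hF hS c
    exact ⟨⟨E', hfd, hgal⟩, hEE', hS', z, hz⟩
  · haveI := E.finiteDimensional
    haveI := E.isGalois
    obtain ⟨E', hfd, hgal, hEE', hS', hz⟩ := h3 hF hS c hc
    exact ⟨⟨E', hfd, hgal⟩, hEE', hS', hz⟩

/-- **NSW's limit statements (iii) `p · H²(U, E_S) = H²(U, E_S)` and (iv) `H³(U, E_S)[p] = 0`** for every open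
`U = H/N_S ≤ G_{K,S}` (`N_S ≤ H ≤ Γ_K` open), `S ⊇ S_p` finite, `K` totally complex: the layer supplies
`exists_layerInf_two_eq_nsmul` (A4-iii) and `exists_layerInf_three_eq_zero` (A4-iv) fed to the (A2) discharge.
[cite: NeukirchSchmidtWingberg2008, (8.3.11) (iii)–(iv), proof of (8.3.18)] -/
theorem sUnits_cohomology_two_three [IsTotallyComplex K] (S : Set (HeightOneSpectrum (𝓞 K))) (hfin : S.Finite)
    (p : ℕ) [Fact p.Prime] (hSp : ∀ v : HeightOneSpectrum (𝓞 K), ((p : ℕ) : 𝓞 K) ∈ v.asIdeal → v ∈ S)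
    (H : Subgroup (absoluteGaloisGroup K)) (hHo : IsOpen (H : Set (absoluteGaloisGroup K)))
    (hNH : ramificationSubgroup K S ≤ H) :
    (∀ y : continuousCohomology 2 (resRep K S H).toTopRep,
        ∃ z : continuousCohomology 2 (resRep K S H).toTopRep, p • z = y) ∧
      (∀ y : continuousCohomology 3 (resRep K S H).toTopRep, p • y = 0 → y = 0) :=
  sUnits_cohomology_of_layerSupply S p H hHo hNH
    (fun hF hS c => exists_layerInf_two_eq_nsmul S hfin p hSp hF hS c)
    (fun hF hS c hc => exists_layerInf_three_eq_zero S hfin p hSp hF hS c hc)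

/-- **NSW (8.3.18) at a TOTALLY COMPLEX `K`: `cd_p G_{K,S} ≤ 2` for every `S ⊇ S_p`** (the Literature predicate
`groupCdLE_two_galoisGroupUnramifiedOutside K`, real-place clause vacuous), via (A5-ω)
`groupCdLE_two_galoisGroupUnramifiedOutside_of_sUnits_cohomology`.
[cite: NeukirchSchmidtWingberg2008, (8.3.18), (10.11.3)] [cite: Harari2020, Lemma 17.21, Cor. 17.14] -/
theorem groupCdLE_two_galoisGroupUnramifiedOutside_of_isTotallyComplex [IsTotallyComplex K] :
    groupCdLE_two_galoisGroupUnramifiedOutside K :=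
  groupCdLE_two_galoisGroupUnramifiedOutside_of_sUnits_cohomology fun S p _ hSf hSp _ H hHo hNS =>
    sUnits_cohomology_two_three S hSf p hSp H hHo hNS

/-- **HARARI THM. 17.13 (a) AT A TOTALLY COMPLEX NUMBER FIELD**: the named fact `poitouTate_restricted_three_le K`
(`P³_S : H³(G_S, M) → ⊕_{v ∈ S} H³(K_v, M)` injective for every `S` and every finite discrete `G_S`-module `M`)
HOLDS — indeed `H³(G_S, M) = 0` (`cd_p G_S ≤ 2` for `p ∣ #M`, no real places).
[cite: Harari2020, Thm. 17.13 (a), Cor. 17.14] [cite: NeukirchSchmidtWingberg2008, (8.3.18), (8.6.10)(ii)] -/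
theorem poitouTate_restricted_three_le_of_isTotallyComplex [IsTotallyComplex K] :
    poitouTate_restricted_three_le K :=
  poitouTate_restricted_three_le_of_sUnits_cohomology fun S p _ hSf hSp H hHo hNS =>
    sUnits_cohomology_two_three S hSf p hSp H hHo hNS

/-- `∀`-closed form: **Harari Thm. 17.13 (a) holds at every totally complex number field.**
[cite: Harari2020, Thm. 17.13 (a)] -/
theorem forall_poitouTate_restricted_three_le_of_isTotallyComplex :
    ∀ (L : Type) [Field L] [NumberField L] [IsTotallyComplex L], poitouTate_restricted_three_le L :=
  fun L _ _ _ => poitouTate_restricted_three_le_of_isTotallyComplex (K := L)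

end Literature.NumberTheory.GaloisCohomology

end
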